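import Summits.NavierStokesRegularity.FunctionalMining.TopEigHeatConvex
import HarnessLib

/-!
# FunctionalMining — the top Rayleigh value of a PLANE SHEAR tensor: `λ(sym(a⊗k))² = |a|²|k|²/4` (tool file)

Search for candidate a priori estimates; no regularity claim. Cell `pub-nsfunc`, prove seat
(gen 19). TOOL FILE (linear algebra only): for vectors `a ⊥ k` in `ℝ³` the symmetric tensor
`sym(a⊗k) = ½(a⊗k + k⊗a)` (the strain of a laminate `x ↦ A(k·x)`, `a = A′`) has top Rayleigh value
`TopEig.lam (shearT a k) = ½|a||k|`; recorded as **`lam_shearT_sq : λ² = (a·a)(k·k)/4`** together with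
`λ ≥ 0` and the same for `−sym(a⊗k) = sym((−a)⊗k)`. Upper bound: `eᵀ sym(a⊗k) e = (a·e)(k·e)` and the
Gram identity `(a·a)(k·k)(e·e) − (k·k)(a·e)² − (a·a)(k·e)² = (e·(a×k))² ≥ 0` (for `a·k = 0`), then AM–GM;
lower bound: the unit vector `(a/|a| + k/|k|)/√2`. Used by `TopEigLaminateRigid` (laminate rigidity of
Lemma L-λ(2) for every lamination direction and polarisation). [ours; folklore linear algebra]
-/

noncomputable section

open Finset Real

namespace Summit.NavierStokesRegularity.FunctionalMining

namespace TopEig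

/-- The plane shear tensor `sym(a⊗k)`, flattened: entries `(aᵢkⱼ + aⱼkᵢ)/2`. [ours; bookkeeping] -/
def shearT (a k : Fin 3 → ℝ) : EuclideanSpace ℝ (Fin 3 × Fin 3) :=
  WithLp.toLp 2 fun p => (a p.1 * k p.2 + a p.2 * k p.1) / 2

/-- Entries of `shearT`. [ours; bookkeeping] -/
@[simp] theorem shearT_apply (a k : Fin 3 → ℝ) (i j : Fin 3) :
    shearT a k (i, j) = (a i * k j + a j * k i) / 2 := rfl

/-- `−sym(a⊗k) = sym((−a)⊗k)`. [ours; bookkeeping] -/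
theorem neg_shearT (a k : Fin 3 → ℝ) : -shearT a k = shearT (-a) k := by
  ext p
  simp only [PiLp.neg_apply, shearT, Pi.neg_apply]
  ring

/-- `sym(a⊗k)` is linear in `a`: `sym((a + t b)⊗k) = sym(a⊗k) + t·sym(b⊗k)`. [ours; bookkeeping] -/
theorem shearT_add_smul (a b k : Fin 3 → ℝ) (t : ℝ) :
    shearT (a + t • b) k = shearT a k + t • shearT b k := by
  ext p
  simp only [shearT, PiLp.add_apply, PiLp.smul_apply, Pi.add_apply, Pi.smul_apply, smul_eq_mul]
  ring

/-- The Rayleigh quotient of a plane shear: `eᵀ sym(a⊗k) e = (a·e)(k·e)`. [ours] -/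
theorem quad_shearT (a k e : Fin 3 → ℝ) : quad (shearT a k) e = (a ⬝ᵥ e) * (k ⬝ᵥ e) := by
  simp only [quad, shearT_apply, dotProduct, Fin.sum_univ_three]
  ring

/-- Gram/Bessel inequality for two orthogonal vectors of `ℝ³`:
`(k·k)(a·e)² + (a·a)(k·e)² ≤ (a·a)(k·k)(e·e)` (the defect is `(e·(a×k))²`). [folklore] -/
theorem gram_ineq {a k : Fin 3 → ℝ} (hak : a ⬝ᵥ k = 0) (e : Fin 3 → ℝ) :
    (k ⬝ᵥ k) * (a ⬝ᵥ e) ^ 2 + (a ⬝ᵥ a) * (k ⬝ᵥ e) ^ 2 ≤ (a ⬝ᵥ a) * (k ⬝ᵥ k) * (e ⬝ᵥ e) := by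
  have hid : (a ⬝ᵥ a) * (k ⬝ᵥ k) * (e ⬝ᵥ e) - (k ⬝ᵥ k) * (a ⬝ᵥ e) ^ 2 - (a ⬝ᵥ a) * (k ⬝ᵥ e) ^ 2
      - (a ⬝ᵥ k) ^ 2 * (e ⬝ᵥ e) + 2 * (a ⬝ᵥ k) * (a ⬝ᵥ e) * (k ⬝ᵥ e) =
      (e 0 * (a 1 * k 2 - a 2 * k 1) + e 1 * (a 2 * k 0 - a 0 * k 2) + e 2 * (a 0 * k 1 - a 1 * k 0)) ^ 2 := by
    simp only [dotProduct, Fin.sum_univ_three]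
    ring
  rw [hak] at hid
  nlinarith [sq_nonneg (e 0 * (a 1 * k 2 - a 2 * k 1) + e 1 * (a 2 * k 0 - a 0 * k 2) +
    e 2 * (a 0 * k 1 - a 1 * k 0))]

/-- **Top Rayleigh value of a plane shear**: for `a ⊥ k` in `ℝ³`,
`λ(sym(a⊗k)) = ½√((a·a)(k·k))`. [ours; folklore] -/
theorem lam_shearT {a k : Fin 3 → ℝ} (hak : a ⬝ᵥ k = 0) :
    lam (shearT a k) = Real.sqrt ((a ⬝ᵥ a) * (k ⬝ᵥ k)) / 2 := by
  set A := a ⬝ᵥ a with hA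
  set K := k ⬝ᵥ k with hK
  have hA0 : 0 ≤ A := dotProduct_self_nonneg' a
  have hK0 : 0 ≤ K := dotProduct_self_nonneg' k
  set r := Real.sqrt (A * K) with hr
  have hr0 : 0 ≤ r := Real.sqrt_nonneg _
  have hr2 : r ^ 2 = A * K := Real.sq_sqrt (mul_nonneg hA0 hK0)
  have hrAK : r = Real.sqrt A * Real.sqrt K := by rw [hr, Real.sqrt_mul hA0]
  apply le_antisymm
  · -- upper bound on every unit vector
    refine lam_le fun e he => ?_
    rw [quad_shearT]
    set p := a ⬝ᵥ e
    set q := k ⬝ᵥ e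
    have hg : K * p ^ 2 + A * q ^ 2 ≤ A * K := by
      have := gram_ineq hak e
      rw [he, mul_one] at this
      exact this
    -- `2 r (p q) ≤ K p² + A q² ≤ A K = r²`
    have h1 : 2 * (Real.sqrt K * p) * (Real.sqrt A * q) ≤ K * p ^ 2 + A * q ^ 2 := by
      have hsK : Real.sqrt K ^ 2 = K := Real.sq_sqrt hK0
      have hsA : Real.sqrt A ^ 2 = A := Real.sq_sqrt hA0
      nlinarith [sq_nonneg (Real.sqrt K * p - Real.sqrt A * q)]
    have h2 : 2 * r * (p * q) ≤ r ^ 2 := by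
      calc 2 * r * (p * q) = 2 * (Real.sqrt K * p) * (Real.sqrt A * q) := by rw [hrAK]; ring
        _ ≤ K * p ^ 2 + A * q ^ 2 := h1
        _ ≤ A * K := hg
        _ = r ^ 2 := hr2.symm
    rcases eq_or_lt_of_le hr0 with h0 | hpos
    · -- `r = 0`: then `A = 0` or `K = 0`, so `p = 0` or `q = 0`
      have hAK : A * K = 0 := by rw [← hr2, ← h0]; ring
      rcases mul_eq_zero.1 hAK with hA' | hK'
      · have ha : a = 0 := (dotProduct_self_eq_zero).1 hA'
        simp [p, ha, ← h0]
      · have hk : k = 0 := (dotProduct_self_eq_zero).1 hK'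
        simp [q, hk, ← h0]
    · have : p * q ≤ r / 2 := by
        rw [le_div_iff₀ (by norm_num : (0 : ℝ) < 2)]
        nlinarith
      exact this
  · -- lower bound
    rcases eq_or_lt_of_le hA0 with hA' | hApos
    · have ha : a = 0 := (dotProduct_self_eq_zero).1 hA'.symm
      have hz : shearT a k = 0 := by ext p; simp [shearT, ha]
      have hrz : r = 0 := by rw [hr, ← hA', zero_mul, Real.sqrt_zero]
      rw [hz, lam_zero, hrz]
      norm_num
    rcases eq_or_lt_of_le hK0 with hK' | hKpos
    · have hk : k = 0 := (dotProduct_self_eq_zero).1 hK'.symm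
      have hz : shearT a k = 0 := by ext p; simp [shearT, hk]
      have hrz : r = 0 := by rw [hr, ← hK', mul_zero, Real.sqrt_zero]
      rw [hz, lam_zero, hrz]
      norm_num
    -- the unit vector `(a/√A + k/√K)/√2`
    set sA := Real.sqrt A
    set sK := Real.sqrt K
    have hsA : sA ^ 2 = A := Real.sq_sqrt hA0
    have hsK : sK ^ 2 = K := Real.sq_sqrt hK0
    have hsApos : 0 < sA := Real.sqrt_pos.2 hApos
    have hsKpos : 0 < sK := Real.sqrt_pos.2 hKpos
    set e : Fin 3 → ℝ := fun i => (a i / sA + k i / sK) / Real.sqrt 2 with he_def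
    have h2 : Real.sqrt 2 ^ 2 = 2 := Real.sq_sqrt (by norm_num)
    have hs2 : 0 < Real.sqrt 2 := Real.sqrt_pos.2 (by norm_num)
    have hka : k ⬝ᵥ a = 0 := by rw [dotProduct_comm]; exact hak
    have hae : a ⬝ᵥ e = sA / Real.sqrt 2 := by
      have : a ⬝ᵥ e = ((a ⬝ᵥ a) / sA + (a ⬝ᵥ k) / sK) / Real.sqrt 2 := by
        simp only [he_def, dotProduct, Fin.sum_univ_three]; ring
      rw [this, hak, zero_div, add_zero, ← hA]
      rw [show A = sA ^ 2 from hsA.symm]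
      field_simp
    have hke : k ⬝ᵥ e = sK / Real.sqrt 2 := by
      have : k ⬝ᵥ e = ((k ⬝ᵥ a) / sA + (k ⬝ᵥ k) / sK) / Real.sqrt 2 := by
        simp only [he_def, dotProduct, Fin.sum_univ_three]; ring
      rw [this, hka, zero_div, zero_add, ← hK]
      rw [show K = sK ^ 2 from hsK.symm]
      field_simp
    have hee : e ⬝ᵥ e = 1 := by
      have : e ⬝ᵥ e = ((a ⬝ᵥ a) / sA ^ 2 + 2 * (a ⬝ᵥ k) / (sA * sK) + (k ⬝ᵥ k) / sK ^ 2) / Real.sqrt 2 ^ 2 := by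
        simp only [he_def, dotProduct, Fin.sum_univ_three]
        field_simp
        ring
      rw [this, hak, ← hA, ← hK, hsA, hsK, h2]
      field_simp
      ring
    have hq : quad (shearT a k) e = r / 2 := by
      rw [quad_shearT, hae, hke, hrAK, div_mul_div_comm, ← sq, h2]
    rw [← hq]
    exact quad_le_lam _ hee

/-- **`λ(sym(a⊗k))² = (a·a)(k·k)/4`, `λ ≥ 0`, and the same for `−sym(a⊗k)`** (`a ⊥ k`). [ours] -/
theorem lam_shearT_sq {a k : Fin 3 → ℝ} (hak : a ⬝ᵥ k = 0) :
    lam (shearT a k) ^ 2 = (a ⬝ᵥ a) * (k ⬝ᵥ k) / 4 ∧ 0 ≤ lam (shearT a k) ∧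
      lam (-shearT a k) ^ 2 = (a ⬝ᵥ a) * (k ⬝ᵥ k) / 4 ∧ 0 ≤ lam (-shearT a k) := by
  have hA0 : 0 ≤ a ⬝ᵥ a := dotProduct_self_nonneg' a
  have hK0 : 0 ≤ k ⬝ᵥ k := dotProduct_self_nonneg' k
  have hnak : (-a) ⬝ᵥ k = 0 := by rw [neg_dotProduct, hak, neg_zero]
  have hna : (-a) ⬝ᵥ (-a) = a ⬝ᵥ a := by simp
  refine ⟨?_, ?_, ?_, ?_⟩
  · rw [lam_shearT hak, div_pow, Real.sq_sqrt (mul_nonneg hA0 hK0)]; norm_num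
  · rw [lam_shearT hak]; positivity
  · rw [neg_shearT, lam_shearT hnak, hna, div_pow, Real.sq_sqrt (mul_nonneg hA0 hK0)]; norm_num
  · rw [neg_shearT, lam_shearT hnak]; positivity

end TopEig

end Summit.NavierStokesRegularity.FunctionalMining

end
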